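import Summits.Ventures.LatticeQCDFlow.Exactness.FreeFieldHMCResonance
import Summits.Ventures.LatticeQCDFlow.Scoring.SchwingerDysonWickLinear
import HarnessLib

/-!
# Every normal mode of the Metropolis-corrected free-field HMC obeys its skeleton's law: `τ_int,traj(O_b) ≥ (1 + cos Nθ_κ)/(2(1 − cos Nθ_κ))`

HONEST FRAMING: exact (Metropolis-corrected) sampling algorithms for lattice gauge theory;
figures of merit are autocorrelation/cost numbers at stated couplings and volumes; no
continuum-physics claim.  (SCALAR calibration rung S0-A: not a gauge result.)

Venture `LatticeQCDFlow` (cell pub-lqcd), topic `Exactness`; FANOUT row 2 (`s0-phi4`, HMC arm).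
NEW WORK of the cell: the zero-mode theorem of `FreeFieldHMCMagnetisationCSD` for EVERY eigenmode `b`
of `−Δ_lat` — Kennedy–Pendleton's mode-by-mode dictionary (1991, named only) as a FLOOR for the
corrected chain; over `FreeFieldHMCZeroMode`, `FreeFieldHMCResonance`, `Scoring/SchwingerDyson*`.
Nothing is cited as a fact.

Setting: free field `S = Σ_x [Σ_μ (φ(σ_μ x) − φ_x)² + m² φ_x²]` (`J = shiftCoupling σ m²`, `λ = 0`),
exact HMC update `K = hmcOpPhi4 J 0 δ N`; `b ≠ 0` with `Σ_μ (2b_x − b(σ_μ x) − b(σ_μ⁻¹ x)) = κ b_x`,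
`Ω² = 2(κ + m²) > 0`, stable regime `δ²Ω² < 4`, `θ = arccos(1 − δ²Ω²/2)`, `c = cos(Nθ)`, `T = Nδ`;
`O_b = Σ_y b_y φ_y`, `P_b = Σ_y b_y p_y`, `|b|² = Σ_y b_y²`, `g = O_b − ⟨O_b⟩`.

## What is proved

* `polyObs_linear`; `free_mode_sq` — `⟨O_b²⟩ = |b|²/Ω²`; `free_mode_mean` — `⟨O_b⟩ = 0`;
  `momentum_linear_sq`, `integral_linear_mul_momentumWeight` — `⟨P_b²⟩_p = |b|²`, `⟨P_b⟩_p = 0`;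
  `free_mode_integral_linear_sq` — `∫∫ (A O_b + B P_b)² e^{−H} = |b|²(A²/Ω² + B²) Z Z_p`;
  **`free_mode_traj_msd_le`** — mean squared accepted jump of `O_b` per trajectory
  `≤ |b|²·2(1 − c)/Ω² · Z_p Z`;
* **`freeHMC_traj_tauInt_ge_mode`** — THE THEOREM: summable autocorrelations of `g` with `ρ_g(1) < 1`
  ⇒ `τ_int,traj(O_b) ≥ (1 + cos Nθ_κ)/(2(1 − cos Nθ_κ))` — the skeleton's exact value for that mode
  (`Scoring.unadjusted_tauInt`); **`freeHMC_traj_tauInt_ge_mode_freq`** — hence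
  `τ_int,traj(O_b) ≥ 2/(Ω_κ² T²) − ½` (`1 − cos Nθ ≤ N²δ²Ω²/2`).

Reading (no numerics implied): mode by mode the corrected HMC is at least as slow as the rotation it
proposes; the slowest floor is the zero mode's (`ξ²/T² − ½`), the others' `2/(Ω_κ²T²) − ½`, resonances
exact (`FreeFieldHMCResonance`).  NOT CLAIMED: `ρ_g(1) < 1` / summability for any run; `λ > 0`.
-/

namespace Summit.Ventures.LatticeQCDFlow.Exactness

open Real MeasureTheory Filter Finset
open Summit.Ventures.LatticeQCDFlow.Scoring
section Free
variable {n : ℕ} {ι : Type*} [Fintype ι]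

/-- A linear observable is of polynomial growth: `|Σ b_y φ_y| ≤ (Σ|b_y|)(1 + Σφ²)`. -/
theorem polyObs_linear (b : Fin (n + 1) → ℝ) : PolyObs (fun φ : Fin (n + 1) → ℝ => ∑ y, b y * φ y) := by
  refine ⟨Finset.measurable_sum _ fun y _ => (measurable_pi_apply y).const_mul _, ∑ y, |b y|, 1,
    fun φ => ?_⟩
  have h1 : ∀ y, |φ y| ≤ 1 + ∑ w, φ w ^ 2 := fun y => by
    have hy : φ y ^ 2 ≤ ∑ w, φ w ^ 2 := Finset.single_le_sum (fun w _ => sq_nonneg (φ w)) (mem_univ y)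
    nlinarith [abs_nonneg (φ y), sq_abs (φ y), sq_nonneg (|φ y| - 1)]
  calc |∑ y, b y * φ y| ≤ ∑ y, |b y * φ y| := abs_sum_le_sum_abs _ _
    _ = ∑ y, |b y| * |φ y| := Finset.sum_congr rfl fun y _ => abs_mul _ _
    _ ≤ ∑ y, |b y| * (1 + ∑ w, φ w ^ 2) :=
        Finset.sum_le_sum fun y _ => mul_le_mul_of_nonneg_left (h1 y) (abs_nonneg _)
    _ = (∑ y, |b y|) * (1 + ∑ w, φ w ^ 2) ^ 1 := by rw [pow_one, Finset.sum_mul]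

/-- **`⟨O_b²⟩ = |b|²/Ω²`** (`Ω² = 2(κ + m²) > 0`): the spectral Schwinger–Dyson relation at `λ = 0`. -/
theorem free_mode_sq (σ : ι → Equiv.Perm (Fin (n + 1))) {m2 κ : ℝ} (hm : 0 < m2)
    {b : Fin (n + 1) → ℝ} (hb : ∀ x, ∑ μ, (2 * b x - b (σ μ x) - b ((σ μ).symm x)) = κ * b x)
    (hκ : 0 < κ + m2) :
    gibbsExpect (shiftCoupling σ m2) 0 (fun φ => (∑ y, b y * φ y) ^ 2) = (∑ y, b y ^ 2) / (2 * (κ + m2)) := by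
  have h := spectral_sd_shift_of_coercive σ (lam := 0) hm (free_coercive σ m2) hb
  simp only [mul_zero, zero_mul, add_zero] at h
  rw [eq_div_iff (by positivity), mul_comm]
  exact h

/-- **`⟨O_b⟩ = 0`** (`Σ_x b_x ∂S/∂φ_x = Ω² O_b`, `⟨∂S/∂φ_x⟩ = 0`). -/
theorem free_mode_mean (σ : ι → Equiv.Perm (Fin (n + 1))) {m2 κ : ℝ} (hm : 0 < m2)
    {b : Fin (n + 1) → ℝ} (hb : ∀ x, ∑ μ, (2 * b x - b (σ μ x) - b ((σ μ).symm x)) = κ * b x)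
    (hκ : 0 < κ + m2) :
    gibbsExpect (shiftCoupling σ m2) 0 (fun φ => ∑ y, b y * φ y) = 0 := by
  have hco := free_coercive σ m2
  have hF : ∀ φ : Fin (n + 1) → ℝ,
      ∑ x, b x * latticePhi4Force (shiftCoupling σ m2) 0 φ x = (2 * (κ + m2)) * ∑ y, b y * φ y := by
    intro φ
    have h := sum_mul_force_shift_of_eigen σ m2 0 hb φ
    simp only [mul_zero, zero_mul, add_zero] at h
    exact h
  have hI : ∀ x, Integrable (fun φ : Fin (n + 1) → ℝ =>
      b x * latticePhi4Force (shiftCoupling σ m2) 0 φ x * gibbsWeight (shiftCoupling σ m2) 0 φ) := by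
    intro x
    refine ((integrable_pow_mul_pow_mul_force_mul_gibbsWeight_of_coercive hm hco x x x 0 0).const_mul
      (b x)).congr (Eventually.of_forall fun φ => ?_)
    simp only [pow_zero, one_mul]
    ring
  have hsum : gibbsExpect (shiftCoupling σ m2) 0
      (fun φ => ∑ x, b x * latticePhi4Force (shiftCoupling σ m2) 0 φ x) = 0 := by
    rw [gibbsExpect_sum (shiftCoupling σ m2) 0 Finset.univ (fun x _ => hI x)]
    refine Finset.sum_eq_zero fun x _ => ?_
    rw [gibbsExpect_const_mul, gibbs_eom_of_coercive hm hco x, mul_zero]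
  have e : (fun φ : Fin (n + 1) → ℝ => ∑ x, b x * latticePhi4Force (shiftCoupling σ m2) 0 φ x)
      = fun φ => (2 * (κ + m2)) * ∑ y, b y * φ y := funext hF
  rw [e, gibbsExpect_const_mul] at hsum
  exact (mul_eq_zero.mp hsum).resolve_left (by positivity : (0 : ℝ) < 2 * (κ + m2)).ne'

/-- **`∫ P_b² e^{−½Σp²} = |b|² Z_p`** (`⟨p_x p_y⟩ = δ_xy`). -/
theorem momentum_linear_sq (b : Fin (n + 1) → ℝ) :
    ∫ p : Fin (n + 1) → ℝ, (∑ y, b y * p y) ^ 2 * momentumWeight p = (∑ y, b y ^ 2) * momentumZ n := by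
  have hZ : 0 < gibbsZ (halfDiag n) 0 := gibbsZ_pos_of_coercive (by norm_num) momentum_coercive
  have h := gibbs_linear_sq_of_coercive (J := halfDiag n) (lam := 0) (ε := 1 / 2) (K := 0)
    (by norm_num) momentum_coercive b
  simp only [momentum_two_point, mul_ite, mul_one, mul_zero, Finset.sum_ite_eq, Finset.mem_univ,
    if_true] at h
  unfold gibbsExpect at h
  rw [div_eq_iff hZ.ne'] at h
  have e : (∑ y, b y ^ 2) = ∑ y, b y * b y := Finset.sum_congr rfl fun y _ => sq (b y)
  rw [momentumZ_eq_gibbsZ, e, ← h]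
  exact integral_congr_ae (Eventually.of_forall fun p => by simp only [momentumWeight_eq_gibbsWeight])

/-- `∫ P_b e^{−½Σp²} = 0`. -/
theorem integral_linear_mul_momentumWeight (b : Fin (n + 1) → ℝ) :
    ∫ p : Fin (n + 1) → ℝ, (∑ y, b y * p y) * momentumWeight p = 0 := by
  simp_rw [Finset.sum_mul]
  rw [integral_finsetSum _ (fun y _ => ((integrable_coord_mul_momentumWeight y).const_mul (b y)).congr
    (Eventually.of_forall fun p => by ring))]
  refine Finset.sum_eq_zero fun y _ => ?_
  rw [show (fun p : Fin (n + 1) → ℝ => b y * p y * momentumWeight p)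
      = fun p => b y * (p y * momentumWeight p) from funext fun p => by ring,
    integral_const_mul, integral_coord_mul_momentumWeight, mul_zero]

/-- The four integrable pieces `O_b² e^{−S}`, `O_b e^{−S}`, `P_b² e^{−K}`, `P_b e^{−K}`. -/
theorem free_mode_pieces (σ : ι → Equiv.Perm (Fin (n + 1))) {m2 : ℝ} (hm : 0 < m2)
    (b : Fin (n + 1) → ℝ) :
    Integrable (fun φ : Fin (n + 1) → ℝ => (∑ y, b y * φ y) ^ 2 * gibbsWeight (shiftCoupling σ m2) 0 φ)
    ∧ Integrable (fun φ : Fin (n + 1) → ℝ => (∑ y, b y * φ y) * gibbsWeight (shiftCoupling σ m2) 0 φ)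
    ∧ Integrable (fun p : Fin (n + 1) → ℝ => (∑ y, b y * p y) ^ 2 * momentumWeight p)
    ∧ Integrable (fun p : Fin (n + 1) → ℝ => (∑ y, b y * p y) * momentumWeight p) := by
  have hco := free_coercive σ m2
  have hO := polyObs_linear (n := n) b
  refine ⟨(polyObs_integrable_mul_mul_gibbsWeight hm hco hO hO).congr
      (Eventually.of_forall fun φ => by dsimp only; ring),
    (polyObs_integrable_mul_mul_gibbsWeight hm hco hO (polyObs_const 1)).congr
      (Eventually.of_forall fun φ => by simp only [mul_one]), ?_, ?_⟩
  · exact (polyObs_integrable_mul_mul_gibbsWeight (J := halfDiag n) (lam := 0) (ε := 1 / 2) (K := 0)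
      (by norm_num) momentum_coercive hO hO).congr (Eventually.of_forall fun p => by
      simp only [momentumWeight_eq_gibbsWeight]; ring)
  · exact (polyObs_integrable_mul_mul_gibbsWeight (J := halfDiag n) (lam := 0) (ε := 1 / 2) (K := 0)
      (by norm_num) momentum_coercive hO (polyObs_const 1)).congr (Eventually.of_forall fun p => by
      simp only [momentumWeight_eq_gibbsWeight, mul_one])

/-- The product-space integrand `(A·O_b + B·P_b)² e^{−S} e^{−K}` is integrable. -/
theorem free_mode_integrable_linear_sq (σ : ι → Equiv.Perm (Fin (n + 1))) {m2 : ℝ} (hm : 0 < m2)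
    (b : Fin (n + 1) → ℝ) (A B : ℝ) :
    Integrable (fun z : (Fin (n + 1) → ℝ) × (Fin (n + 1) → ℝ) =>
        (A * ∑ y, b y * z.1 y + B * ∑ y, b y * z.2 y) ^ 2
          * (gibbsWeight (shiftCoupling σ m2) 0 z.1 * momentumWeight z.2))
      ((volume : Measure (Fin (n + 1) → ℝ)).prod volume) := by
  obtain ⟨iO2, iO1, iP2, iP1⟩ := free_mode_pieces σ hm b
  have hI1 := iO2.mul_prod (integrable_momentumWeight (n := n))
  have hI2 := iO1.mul_prod iP1
  have hI3 := (integrable_gibbsWeight_of_coercive hm (free_coercive σ m2)).mul_prod iP2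
  refine (((hI1.const_mul (A ^ 2)).add (hI2.const_mul (2 * A * B))).add
    (hI3.const_mul (B ^ 2))).congr (Eventually.of_forall fun z => ?_)
  simp only [Pi.add_apply]
  ring

/-- **`∫∫ (A·O_b + B·P_b)² e^{−H} = |b|²(A²/Ω² + B²) Z Z_p`** (free field, `Ω² = 2(κ+m²) > 0`). -/
theorem free_mode_integral_linear_sq (σ : ι → Equiv.Perm (Fin (n + 1))) {m2 κ : ℝ} (hm : 0 < m2)
    {b : Fin (n + 1) → ℝ} (hb : ∀ x, ∑ μ, (2 * b x - b (σ μ x) - b ((σ μ).symm x)) = κ * b x)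
    (hκ : 0 < κ + m2) (A B : ℝ) :
    ∫ z : (Fin (n + 1) → ℝ) × (Fin (n + 1) → ℝ),
        (A * ∑ y, b y * z.1 y + B * ∑ y, b y * z.2 y) ^ 2
          * (gibbsWeight (shiftCoupling σ m2) 0 z.1 * momentumWeight z.2)
        ∂((volume : Measure (Fin (n + 1) → ℝ)).prod volume)
      = (∑ y, b y ^ 2) * (A ^ 2 / (2 * (κ + m2)) + B ^ 2)
          * (gibbsZ (shiftCoupling σ m2) 0 * momentumZ n) := by
  have hZ := gibbsZ_pos_of_coercive hm (free_coercive σ m2)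
  obtain ⟨iO2, iO1, iP2, iP1⟩ := free_mode_pieces σ hm b
  have hI1 := iO2.mul_prod (integrable_momentumWeight (n := n))
  have hI2 := iO1.mul_prod iP1
  have hI3 := (integrable_gibbsWeight_of_coercive hm (free_coercive σ m2)).mul_prod iP2
  have e : ∀ z : (Fin (n + 1) → ℝ) × (Fin (n + 1) → ℝ),
      (A * ∑ y, b y * z.1 y + B * ∑ y, b y * z.2 y) ^ 2
        * (gibbsWeight (shiftCoupling σ m2) 0 z.1 * momentumWeight z.2)
      = A ^ 2 * (((∑ y, b y * z.1 y) ^ 2 * gibbsWeight (shiftCoupling σ m2) 0 z.1) * momentumWeight z.2)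
        + 2 * A * B * (((∑ y, b y * z.1 y) * gibbsWeight (shiftCoupling σ m2) 0 z.1)
            * ((∑ y, b y * z.2 y) * momentumWeight z.2))
        + B ^ 2 * (gibbsWeight (shiftCoupling σ m2) 0 z.1 * ((∑ y, b y * z.2 y) ^ 2 * momentumWeight z.2)) := by
    intro z; ring
  simp_rw [e]
  have h12 : Integrable (fun z : (Fin (n + 1) → ℝ) × (Fin (n + 1) → ℝ) =>
      A ^ 2 * (((∑ y, b y * z.1 y) ^ 2 * gibbsWeight (shiftCoupling σ m2) 0 z.1) * momentumWeight z.2)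
        + 2 * A * B * (((∑ y, b y * z.1 y) * gibbsWeight (shiftCoupling σ m2) 0 z.1)
            * ((∑ y, b y * z.2 y) * momentumWeight z.2)))
      ((volume : Measure (Fin (n + 1) → ℝ)).prod volume) := (hI1.const_mul _).add (hI2.const_mul _)
  rw [integral_add h12 (hI3.const_mul _), integral_add (hI1.const_mul _) (hI2.const_mul _),
    integral_const_mul, integral_const_mul, integral_const_mul,
    integral_prod_mul (f := fun φ : Fin (n + 1) → ℝ => (∑ y, b y * φ y) ^ 2 * gibbsWeight (shiftCoupling σ m2) 0 φ)
      (g := momentumWeight),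
    integral_prod_mul (f := fun φ : Fin (n + 1) → ℝ => (∑ y, b y * φ y) * gibbsWeight (shiftCoupling σ m2) 0 φ)
      (g := fun p : Fin (n + 1) → ℝ => (∑ y, b y * p y) * momentumWeight p),
    integral_prod_mul (f := gibbsWeight (shiftCoupling σ m2) 0)
      (g := fun p : Fin (n + 1) → ℝ => (∑ y, b y * p y) ^ 2 * momentumWeight p),
    integral_linear_mul_momentumWeight, momentum_linear_sq]
  have hO2 : ∫ φ : Fin (n + 1) → ℝ, (∑ y, b y * φ y) ^ 2 * gibbsWeight (shiftCoupling σ m2) 0 φ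
      = (∑ y, b y ^ 2) / (2 * (κ + m2)) * gibbsZ (shiftCoupling σ m2) 0 := by
    have h := free_mode_sq σ hm hb hκ
    unfold gibbsExpect at h
    rwa [div_eq_iff hZ.ne'] at h
  rw [hO2]
  unfold momentumZ gibbsZ
  ring

/-- **THE MEAN SQUARED ACCEPTED JUMP OF THE MODE IS AT MOST `|b|²·2(1 − cos Nθ)/Ω²`** (units `Z_p Z`). -/
theorem free_mode_traj_msd_le (σ : ι → Equiv.Perm (Fin (n + 1))) {m2 δ κ : ℝ} (hδ : 0 < δ)
    (hm : 0 < m2) {b : Fin (n + 1) → ℝ}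
    (hb : ∀ x, ∑ μ, (2 * b x - b (σ μ x) - b ((σ μ).symm x)) = κ * b x)
    (hκ : 0 < κ + m2) (hst : δ ^ 2 * (2 * (κ + m2)) < 4) (N : ℕ) :
    ∫ z : (Fin (n + 1) → ℝ) × (Fin (n + 1) → ℝ),
        involAccept (phi4HmcEnergy (shiftCoupling σ m2) 0) (hmcProposal (shiftCoupling σ m2) 0 δ N) z
          * ((∑ y, b y * (hmcProposal (shiftCoupling σ m2) 0 δ N z).1 y) - ∑ y, b y * z.1 y) ^ 2
          * Real.exp (-phi4HmcEnergy (shiftCoupling σ m2) 0 z)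
        ∂((volume : Measure (Fin (n + 1) → ℝ)).prod volume)
      ≤ (∑ y, b y ^ 2) * (2 * (1 - Real.cos (N * Real.arccos (1 - δ ^ 2 * (2 * (κ + m2)) / 2))))
          / (2 * (κ + m2)) * (momentumZ n * gibbsZ (shiftCoupling σ m2) 0) := by
  set θ := Real.arccos (1 - δ ^ 2 * (2 * (κ + m2)) / 2) with hθ
  set c := Real.cos (N * θ) with hc
  set s := Real.sin (N * θ) with hs
  set β := δ * (1 - δ ^ 2 * (2 * (κ + m2)) / 4) / Real.sin θ with hβ
  set H := phi4HmcEnergy (shiftCoupling σ m2) 0 with hH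
  set Ψ := hmcProposal (shiftCoupling σ m2) 0 δ N with hΨ
  have hw2 : (0 : ℝ) < 2 * (κ + m2) := by positivity
  have hZ := gibbsZ_pos_of_coercive hm (free_coercive σ m2)
  have hZp := momentumZ_pos n
  have hb2 : 0 ≤ ∑ y, b y ^ 2 := Finset.sum_nonneg fun y _ => sq_nonneg _
  have ejump : ∀ z : (Fin (n + 1) → ℝ) × (Fin (n + 1) → ℝ),
      ((∑ y, b y * (Ψ z).1 y) - ∑ y, b y * z.1 y) ^ 2 * Real.exp (-H z)
      = ((c - 1) * ∑ y, b y * z.1 y + (β * s) * ∑ y, b y * z.2 y) ^ 2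
          * (gibbsWeight (shiftCoupling σ m2) 0 z.1 * momentumWeight z.2) := by
    intro z
    rw [hΨ, free_mode_hmcProposal σ hδ hb hκ hst N z, exp_neg_phi4HmcEnergy, hβ]
    ring
  have hint : Integrable (fun z : (Fin (n + 1) → ℝ) × (Fin (n + 1) → ℝ) =>
      ((∑ y, b y * (Ψ z).1 y) - ∑ y, b y * z.1 y) ^ 2 * Real.exp (-H z))
      ((volume : Measure (Fin (n + 1) → ℝ)).prod volume) :=
    (free_mode_integrable_linear_sq σ hm b (c - 1) (β * s)).congr
      (Eventually.of_forall fun z => (ejump z).symm)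
  have hmono : ∫ z, involAccept H Ψ z * ((∑ y, b y * (Ψ z).1 y) - ∑ y, b y * z.1 y) ^ 2
        * Real.exp (-H z) ∂((volume : Measure (Fin (n + 1) → ℝ)).prod volume)
      ≤ ∫ z, ((∑ y, b y * (Ψ z).1 y) - ∑ y, b y * z.1 y) ^ 2 * Real.exp (-H z)
        ∂((volume : Measure (Fin (n + 1) → ℝ)).prod volume) := by
    refine integral_mono_of_nonneg (Eventually.of_forall fun z =>
      mul_nonneg (mul_nonneg (involAccept_nonneg H Ψ z) (sq_nonneg _)) (Real.exp_pos _).le) hint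
      (Eventually.of_forall fun z => ?_)
    have h0 : 0 ≤ ((∑ y, b y * (Ψ z).1 y) - ∑ y, b y * z.1 y) ^ 2 * Real.exp (-H z) :=
      mul_nonneg (sq_nonneg _) (Real.exp_pos _).le
    calc involAccept H Ψ z * ((∑ y, b y * (Ψ z).1 y) - ∑ y, b y * z.1 y) ^ 2 * Real.exp (-H z)
        = involAccept H Ψ z * (((∑ y, b y * (Ψ z).1 y) - ∑ y, b y * z.1 y) ^ 2 * Real.exp (-H z)) := by
          ring
      _ ≤ 1 * (((∑ y, b y * (Ψ z).1 y) - ∑ y, b y * z.1 y) ^ 2 * Real.exp (-H z)) :=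
          mul_le_mul_of_nonneg_right (involAccept_le_one H Ψ z) h0
      _ = _ := one_mul _
  refine hmono.trans ?_
  simp_rw [ejump]
  rw [free_mode_integral_linear_sq σ hm hb hκ]
  have hβ2 : β ^ 2 ≤ 1 / (2 * (κ + m2)) := rotation_beta_sq_le hδ hw2 hst
  have hs2 : s ^ 2 = 1 - c ^ 2 := by rw [hs, hc, Real.sin_sq]
  have hkey : (c - 1) ^ 2 / (2 * (κ + m2)) + (β * s) ^ 2 ≤ 2 * (1 - c) / (2 * (κ + m2)) := by
    have h1 : (β * s) ^ 2 ≤ (1 - c ^ 2) / (2 * (κ + m2)) := by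
      rw [mul_pow, ← hs2]
      calc β ^ 2 * s ^ 2 ≤ 1 / (2 * (κ + m2)) * s ^ 2 := mul_le_mul_of_nonneg_right hβ2 (sq_nonneg _)
        _ = s ^ 2 / (2 * (κ + m2)) := by ring
    rw [show 2 * (1 - c) / (2 * (κ + m2)) = (c - 1) ^ 2 / (2 * (κ + m2)) + (1 - c ^ 2) / (2 * (κ + m2))
      by field_simp; ring]
    exact add_le_add le_rfl h1
  calc (∑ y, b y ^ 2) * ((c - 1) ^ 2 / (2 * (κ + m2)) + (β * s) ^ 2)
        * (gibbsZ (shiftCoupling σ m2) 0 * momentumZ n)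
      ≤ (∑ y, b y ^ 2) * (2 * (1 - c) / (2 * (κ + m2))) * (gibbsZ (shiftCoupling σ m2) 0 * momentumZ n) :=
        mul_le_mul_of_nonneg_right (mul_le_mul_of_nonneg_left hkey hb2) (mul_pos hZ hZp).le
    _ = (∑ y, b y ^ 2) * (2 * (1 - c)) / (2 * (κ + m2)) * (momentumZ n * gibbsZ (shiftCoupling σ m2) 0) := by
        ring

/-- **No resonance under `ρ_g(1) < 1`** (`b ≠ 0`): a resonant mode has `ρ_g ≡ 1`. -/
theorem free_mode_cos_ne_one (σ : ι → Equiv.Perm (Fin (n + 1))) {m2 δ κ : ℝ} (hδ : 0 < δ)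
    (hm : 0 < m2) {b : Fin (n + 1) → ℝ} (hb0 : 0 < ∑ y, b y ^ 2)
    (hb : ∀ x, ∑ μ, (2 * b x - b (σ μ x) - b ((σ μ).symm x)) = κ * b x)
    (hκ : 0 < κ + m2) (hst : δ ^ 2 * (2 * (κ + m2)) < 4) {N : ℕ}
    (hρ : (∫ φ, ((∑ y, b y * φ y) - gibbsExpect (shiftCoupling σ m2) 0 (fun ψ => ∑ y, b y * ψ y))
        * hmcOpPhi4 (shiftCoupling σ m2) 0 δ N
            (fun ψ => (∑ y, b y * ψ y) - gibbsExpect (shiftCoupling σ m2) 0 (fun ψ => ∑ y, b y * ψ y)) φ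
        * gibbsWeight (shiftCoupling σ m2) 0 φ)
        / (∫ φ, ((∑ y, b y * φ y) - gibbsExpect (shiftCoupling σ m2) 0 (fun ψ => ∑ y, b y * ψ y)) ^ 2
          * gibbsWeight (shiftCoupling σ m2) 0 φ) < 1) :
    Real.cos (N * Real.arccos (1 - δ ^ 2 * (2 * (κ + m2)) / 2)) ≠ 1 := by
  intro h1
  have hZ := gibbsZ_pos_of_coercive hm (free_coercive σ m2)
  have hk := free_mode_resonance_autocov σ hδ hb hκ hst h1 (fun t => t)
    (gibbsWeight (shiftCoupling σ m2) 0) 1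
  simp only [Function.iterate_one] at hk
  rw [free_mode_mean σ hm hb hκ] at hρ
  simp only [sub_zero] at hρ
  have hpos : 0 < ∫ φ : Fin (n + 1) → ℝ, (∑ y, b y * φ y) ^ 2 * gibbsWeight (shiftCoupling σ m2) 0 φ := by
    have h := free_mode_sq σ hm hb hκ
    unfold gibbsExpect at h
    rw [div_eq_iff hZ.ne'] at h
    rw [h]
    exact mul_pos (by positivity) hZ
  rw [hk, div_self hpos.ne'] at hρ
  exact lt_irrefl _ hρ

/-- **EVERY MODE OF THE METROPOLIS-CORRECTED FREE-FIELD HMC OBEYS ITS SKELETON'S LAW**: `b ≠ 0`,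
`Ω² = 2(κ + m²) > 0`, `δ²Ω² < 4`, `g = O_b − ⟨O_b⟩` summable with `ρ_g(1) < 1` ⇒
`τ_int,traj(O_b) ≥ (1 + cos Nθ)/(2(1 − cos Nθ))`. -/
theorem freeHMC_traj_tauInt_ge_mode (σ : ι → Equiv.Perm (Fin (n + 1))) {m2 δ κ : ℝ} (hδ : 0 < δ)
    (hm : 0 < m2) {b : Fin (n + 1) → ℝ} (hb0 : 0 < ∑ y, b y ^ 2)
    (hb : ∀ x, ∑ μ, (2 * b x - b (σ μ x) - b ((σ μ).symm x)) = κ * b x)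
    (hκ : 0 < κ + m2) (hst : δ ^ 2 * (2 * (κ + m2)) < 4) (N : ℕ)
    (hs : Summable fun k => (∫ φ, ((∑ y, b y * φ y)
          - gibbsExpect (shiftCoupling σ m2) 0 (fun ψ => ∑ y, b y * ψ y))
        * ((hmcOpPhi4 (shiftCoupling σ m2) 0 δ N)^[k + 1]
            (fun ψ => (∑ y, b y * ψ y) - gibbsExpect (shiftCoupling σ m2) 0 (fun ψ => ∑ y, b y * ψ y))) φ
        * gibbsWeight (shiftCoupling σ m2) 0 φ)
        / ∫ φ, ((∑ y, b y * φ y) - gibbsExpect (shiftCoupling σ m2) 0 (fun ψ => ∑ y, b y * ψ y)) ^ 2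
          * gibbsWeight (shiftCoupling σ m2) 0 φ)
    (hρ : (∫ φ, ((∑ y, b y * φ y) - gibbsExpect (shiftCoupling σ m2) 0 (fun ψ => ∑ y, b y * ψ y))
        * hmcOpPhi4 (shiftCoupling σ m2) 0 δ N
            (fun ψ => (∑ y, b y * ψ y) - gibbsExpect (shiftCoupling σ m2) 0 (fun ψ => ∑ y, b y * ψ y)) φ
        * gibbsWeight (shiftCoupling σ m2) 0 φ)
        / (∫ φ, ((∑ y, b y * φ y) - gibbsExpect (shiftCoupling σ m2) 0 (fun ψ => ∑ y, b y * ψ y)) ^ 2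
          * gibbsWeight (shiftCoupling σ m2) 0 φ) < 1) :
    (1 + Real.cos (N * Real.arccos (1 - δ ^ 2 * (2 * (κ + m2)) / 2)))
        / (2 * (1 - Real.cos (N * Real.arccos (1 - δ ^ 2 * (2 * (κ + m2)) / 2))))
      ≤ tauInt (fun k => (∫ φ, ((∑ y, b y * φ y)
          - gibbsExpect (shiftCoupling σ m2) 0 (fun ψ => ∑ y, b y * ψ y))
        * ((hmcOpPhi4 (shiftCoupling σ m2) 0 δ N)^[k]
            (fun ψ => (∑ y, b y * ψ y) - gibbsExpect (shiftCoupling σ m2) 0 (fun ψ => ∑ y, b y * ψ y))) φ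
        * gibbsWeight (shiftCoupling σ m2) 0 φ)
        / ∫ φ, ((∑ y, b y * φ y) - gibbsExpect (shiftCoupling σ m2) 0 (fun ψ => ∑ y, b y * ψ y)) ^ 2
          * gibbsWeight (shiftCoupling σ m2) 0 φ) := by
  set c := Real.cos (N * Real.arccos (1 - δ ^ 2 * (2 * (κ + m2)) / 2)) with hc_def
  have hc : c ≠ 1 := free_mode_cos_ne_one σ hδ hm hb0 hb hκ hst hρ
  have h1c : 0 < 1 - c := sub_pos.mpr (lt_of_le_of_ne (Real.cos_le_one _) hc)
  have hvar : gibbsExpect (shiftCoupling σ m2) 0 (fun φ =>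
      ((∑ y, b y * φ y) - gibbsExpect (shiftCoupling σ m2) 0 (fun ψ => ∑ y, b y * ψ y)) ^ 2)
      = (∑ y, b y ^ 2) / (2 * (κ + m2)) := by
    simp only [free_mode_mean σ hm hb hκ, sub_zero]
    exact free_mode_sq σ hm hb hκ
  obtain ⟨C, hC1, hCg⟩ := hmcProposal_growth (shiftCoupling σ m2) 0 δ N
  have hD := free_mode_traj_msd_le σ hδ hm hb hκ hst N
  have h := hmc_tauInt_ge_of_msd_le_poly_of_coercive hm (free_coercive σ m2)
    (measurable_hmcProposal (shiftCoupling σ m2) 0 δ N)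
    (hmcProposal_involutive (shiftCoupling σ m2) 0 δ N)
    (measurePreserving_hmcProposal (shiftCoupling σ m2) 0 δ N)
    (zero_le_one.trans hC1) hCg (polyObs_linear b) hD hs hρ
  rw [hvar] at h
  have e : 2 * ((∑ y, b y ^ 2) / (2 * (κ + m2)))
      / ((∑ y, b y ^ 2) * (2 * (1 - c)) / (2 * (κ + m2))) - 1 / 2 = (1 + c) / (2 * (1 - c)) := by
    field_simp
    ring
  rw [e] at h
  exact h

/-- **Hence `τ_int,traj(O_b) ≥ 2/(Ω² T²) − ½`** (`Ω² = 2(κ + m²)`, `T = Nδ`; `κ = 0`: `ξ²/T² − ½`). -/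
theorem freeHMC_traj_tauInt_ge_mode_freq (σ : ι → Equiv.Perm (Fin (n + 1))) {m2 δ κ : ℝ}
    (hδ : 0 < δ) (hm : 0 < m2) {b : Fin (n + 1) → ℝ} (hb0 : 0 < ∑ y, b y ^ 2)
    (hb : ∀ x, ∑ μ, (2 * b x - b (σ μ x) - b ((σ μ).symm x)) = κ * b x)
    (hκ : 0 < κ + m2) (hst : δ ^ 2 * (2 * (κ + m2)) < 4) (N : ℕ)
    (hs : Summable fun k => (∫ φ, ((∑ y, b y * φ y)
          - gibbsExpect (shiftCoupling σ m2) 0 (fun ψ => ∑ y, b y * ψ y))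
        * ((hmcOpPhi4 (shiftCoupling σ m2) 0 δ N)^[k + 1]
            (fun ψ => (∑ y, b y * ψ y) - gibbsExpect (shiftCoupling σ m2) 0 (fun ψ => ∑ y, b y * ψ y))) φ
        * gibbsWeight (shiftCoupling σ m2) 0 φ)
        / ∫ φ, ((∑ y, b y * φ y) - gibbsExpect (shiftCoupling σ m2) 0 (fun ψ => ∑ y, b y * ψ y)) ^ 2
          * gibbsWeight (shiftCoupling σ m2) 0 φ)
    (hρ : (∫ φ, ((∑ y, b y * φ y) - gibbsExpect (shiftCoupling σ m2) 0 (fun ψ => ∑ y, b y * ψ y))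
        * hmcOpPhi4 (shiftCoupling σ m2) 0 δ N
            (fun ψ => (∑ y, b y * ψ y) - gibbsExpect (shiftCoupling σ m2) 0 (fun ψ => ∑ y, b y * ψ y)) φ
        * gibbsWeight (shiftCoupling σ m2) 0 φ)
        / (∫ φ, ((∑ y, b y * φ y) - gibbsExpect (shiftCoupling σ m2) 0 (fun ψ => ∑ y, b y * ψ y)) ^ 2
          * gibbsWeight (shiftCoupling σ m2) 0 φ) < 1) :
    2 / ((2 * (κ + m2)) * ((N : ℝ) * δ) ^ 2) - 1 / 2
      ≤ tauInt (fun k => (∫ φ, ((∑ y, b y * φ y)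
          - gibbsExpect (shiftCoupling σ m2) 0 (fun ψ => ∑ y, b y * ψ y))
        * ((hmcOpPhi4 (shiftCoupling σ m2) 0 δ N)^[k]
            (fun ψ => (∑ y, b y * ψ y) - gibbsExpect (shiftCoupling σ m2) 0 (fun ψ => ∑ y, b y * ψ y))) φ
        * gibbsWeight (shiftCoupling σ m2) 0 φ)
        / ∫ φ, ((∑ y, b y * φ y) - gibbsExpect (shiftCoupling σ m2) 0 (fun ψ => ∑ y, b y * ψ y)) ^ 2
          * gibbsWeight (shiftCoupling σ m2) 0 φ) := by
  set c := Real.cos (N * Real.arccos (1 - δ ^ 2 * (2 * (κ + m2)) / 2)) with hc_def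
  have hmain := freeHMC_traj_tauInt_ge_mode σ hδ hm hb0 hb hκ hst N hs hρ
  have hc : c ≠ 1 := free_mode_cos_ne_one σ hδ hm hb0 hb hκ hst hρ
  have h1c : 0 < 1 - c := sub_pos.mpr (lt_of_le_of_ne (Real.cos_le_one _) hc)
  have hw2 : (0 : ℝ) < 2 * (κ + m2) := by positivity
  have hle : 1 - c ≤ ((N : ℝ) * δ) ^ 2 * (2 * (κ + m2)) / 2 := one_sub_cos_traj_le hw2 hst N
  refine le_trans ?_ hmain
  rw [show (1 + c) / (2 * (1 - c)) = 1 / (1 - c) - 1 / 2 by field_simp; ring]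
  refine sub_le_sub_right ?_ _
  rw [show 2 / (2 * (κ + m2) * ((N : ℝ) * δ) ^ 2) = 1 / (((N : ℝ) * δ) ^ 2 * (2 * (κ + m2)) / 2) by
    field_simp]
  exact one_div_le_one_div_of_le h1c hle

end Free

end Summit.Ventures.LatticeQCDFlow.Exactness
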